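import Summits.QuantumFields.YangMills.Theorems.BalabanUVNodesK2NamedJetsRemAt
import Summits.QuantumFields.BalabanUV.Gaps.EndSurvivorCensus

/-!
# Crux K2⁷ `EndpointGivenBR13SepCoPH` (stmt-QuantumFields-20543), LINE 1′ «named jets» — THE RUN EDITION `RunRemAt F κ θ hP c` OF THE SHARED LETTER OF RECORD:
# the ed.3 letter `RemAt F κ θ hP c` (p593586) with its two XL conjuncts RESTRICTED TO THE IN-WINDOW RG RUNS of the datum's own construction (constant remainder along
# runs, (C) on the survivor sets), the per-scale ANCHOR kept BOX-wise; the END from it by the TREE's run-wise road (`Gaps/EndSurvivorCensus`) BY NAME; the run-wise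
# stub pair {1ᴮ″, 2ᴮ″} composed to the crux decl BY NAME, consuming the item's unity guard `hU` and (B) `hB`

Cell `ym-nodeO-ideate`, DEFINER seat `ym-nodeO-def-1` (gen 3; director-ym R361 ∕ №21 ∕ LINE №204).  TRIGGER: director-ym LINE №204 («idea-4 `runs-given-b` SURVIVES as RE-CUT
with REQUIRED reshape — re-key to DEF-1 ed.3 letter p593586 RUN-RESTRICTION») + CRIT-1 g3's verdict `Cruxes/EndpointGivenBR13SepCoPH/CRIT-1-runs-given-b.md` §5 (R) + idea-4
g3's answer (card `Cruxes/EndpointGivenBR13SepCoPH/Ideas/runs-given-b.md` ed.3, sketch `Cruxes/EndpointGivenBR13SepCoPH/RunsGivenBSketch3.lean`, farm-clean).  Helper for crux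
K2⁷ = stmt-QuantumFields-20543, landed `--supports 20543 --as helper`; count-neutral.  Third file of the letter lineage after `Thm/BalabanUVNodesK2JsOfRecord` (p588621:
`StepColourData`, `JsOfRecord`, `beta0OfJs`, `BoxRemainder`) and `Thm/BalabanUVNodesK2NamedJetsRemAt` (p593586: `ConstRemainder`, `ScaleAnchor`, `RemAt` ed.3, the box
concluder `EndpointGivenBR13SepCoPH_of_shadowingJets` registered in plan g81's K2⁷ skeleton v4 e802584ecf0c3a42).

AUTHORSHIP ∕ ATTRIBUTION.  The mathematics and the Lean text of §1–§2 and of the §3 compositions are idea-4 g3's (`RunsGivenBSketch3.lean`, seat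
planner-ym-nodeO-idea-4-g3-0 — a planner seat, which files nothing under `Theorems/` by mandate; «provers may port»), themselves a thin layer over the TREE's run-wise END
road `Summits/QuantumFields/BalabanUV/Gaps/EndSurvivorCensus` (g1-plan-2 GEN 19 ∕ pub-balaban-gaps g1-p3: survivor sets, Tietze extension, run-wise (PS) shooting) and over
this seat's ed.3 letter.  This seat's part: the port as THE ONE DECLARER of the letter (plan g80∕dag-lead DEDUP-366: «DEF-1 = ONE declarer of `RemAt`»), the stub texts
spelled INLINE (no parameterless `def … : Prop` under `Theorems/`), `RunConstRemainder.mono`, `runRemAt_iff_hPFree`, `beta0OfJs_eq_of_runRemAt(_adm)`,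
`runPackage_of_runRemAt_drift`, `d1AtShadowingJets_of_d1AtRunShadowingJets`, this header, and the kernel re-check against the tree.  WHY IN THE TREE NOW: the plan registers
stub texts only over TREE letters BY NAME (v4 waited for p593586 LANDED+BUILT); with this file a plan cut CAN register the run-wise 2ᴮ″ — the choice stays the plan's.

WHAT `RunRemAt` IS.  `RemAt F κ θ hP c := ∃ γ₀ s, 0 < γ₀ ∧ γ₀ ≤ θ.γ ∧ s ≤ c·stepBal 2 F.L ∧ ConstRemainder β (c • b) s γ₀ ∧ ScaleAnchor β (c • b) ∧ BetaContH γ₀ β`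
(`β := (datumOfRecord₁₃SepCoPH F 2 θ hP).βfun`, `b := beta0OfJs F κ`) becomes
`RunRemAt F κ θ hP c := ∃ γ₀ s, 0 < γ₀ ∧ γ₀ ≤ θ.γ ∧ s ≤ c·stepBal 2 F.L ∧ RunConstRemainder β (c • b) s γ₀ ∧ ScaleAnchor β (c • b) ∧ SurvCont β γ₀`:
* `RunConstRemainder` = `|β_{k+1}(g_0,…,g_k) − c·b_k| ≤ s` at every prefix of every solution of (0.20) up to `n` that stays in `]0, γ₀]` ([I] Thm 3 p. 264 reads β exactly
  along such runs) — the shape of the `hrun` letter of `Gaps.EndSurvivorCensus.endpointExistence_of_survivorLetters_runwisePS`;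
* `SurvCont` = Gaps' survivor-continuity letter VERBATIM (each trace `x ↦ β_k(clampPrefix β γ₀ k x)` continuous ON the survivor set of level `γ₀`);
* the ANCHOR is KEPT BOX-WISE and stays LOAD-BEARING (ed.3 header): it is the identification clause (`beta0OfJs_eq_of_runRemAt`) on which stub 1′∕1ᴮ″'s fixed slope rests;
  a run-restricted anchor would identify the numbers at depth `k` only from runs of depth `> k` at arbitrarily small levels — END-type information, i.e. what is being proved.
* κ is a letter ((P6) UNPINNED); the normalisation is CARRIED by `c` (the stub texts put `c := θ.cβ`; a sub-cell convention constant `c⋆ ≠ 1` would put `θ.cβ / c⋆` — a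
  stub-text token, not a letter edit); `hP` is a PHANTOM binder (`runRemAt_iff_hPFree`).
Box letter ⟹ run letter at every scale (`runRemAt_of_remAt`): 2ᴮ″ is WEAKER than v4's 2′ BY NAME (`runRemAtSomeJetsGivenB_of_remAtSomeJets`), 1ᴮ″ is STRONGER than v4's 1′
(`d1AtShadowingJets_of_d1AtRunShadowingJets`) and both 1′-forms follow from the ONE anchor-keyed (D1) road (`d1AtRunShadowingJets_of_drift_of_anchor`, hypothesis VERBATIM =
ed.3's `d1AtShadowingJets_of_drift_of_anchor`).  The run-wise stub texts (idea-4 ed.3, CRIT-1's sanctioned key: κ AFTER θ, `θ.cβ` carried, slope `θ.cβ·stepBal 2 F.L`):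
  2ᴮ″ `∀ F θ hP, (θ.ZhUnity F 2 ∧ θ.SlotsNondegenerate₁₃ F 2) → θ.Admissible F 2 → B16.EndStatementBPrinted (datumOfRecord₁₃SepCoPH F 2 θ hP).C → ∃ κ, RunRemAt F κ θ hP θ.cβ`
  1ᴮ″ `∀ F κ θ hP, θ.Admissible F 2 → RunRemAt F κ θ hP θ.cβ → ∃ A, OneLoopDrift (stepBal 2 F.L) A (beta0OfJs F κ)`
and ★★ `EndpointGivenBR13SepCoPH_of_runShadowingJetsGivenB` takes them INLINE to the crux decl BY NAME (`hU`, `hB` CONSUMED — the first line-1′ composition to read them;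
`hwin` unused).  LOCATED for a K1-side reader (dag-n24): run data give run-wise (PS) `M = 2|c|A` and PER-LEVEL survivor bounds (`runPackage_of_runRemAt_drift`) — NO box
ceiling `BetaUpperH` and NO box floor are recoverable from the run edition (contrast `constAnchorPackage_of_remAt_drift` of ed.3).  What idea-4's ed.2 currency dropped on
CRIT-1's (R): the g-proportional `C_r·g_k` (END needs `s ≤ c·stepBal` only) and the `∀ F ∃ κ ∀ θ` prefix (the p592392 shape).  The landed negatives are honoured exactly as by
the box pair: κ AFTER θ and named numbers at scale `θ.cβ` (p592392 `RemNamedJets13FalseOfTwoNormalisations`), no `v₀`-pinned split (p592695 `Anchor13FalseOfTwoBaseHistories`).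

WHAT IS HERE (4 `def`s — 1 `Set ℝ` + 3 `Prop` PREDICATES with parameters, hypothesis shapes never facts — + 17 theorems; 0 `sorry`; elementary real bookkeeping BY NAME):
§1 generic (`β : HBeta`, `b : ℕ → ℝ`): `Survivors`, `RunConstRemainder`, `SurvCont`, `RunConstRemainder.mono`, `runConstRemainder_of_constRemainder`, `SurvCont.of_betaContH`,
`run_of_survivor`, `survUpper_of_runConstRemainder`, `runwisePS_of_drift_runConstRemainder`, ★ `endpointExistence_of_drift_runConstRemainder_survCont`.  §2 the run letter
`RunRemAt`, `runRemAt_iff_hPFree`, `runRemAt_of_remAt`, `beta0OfJs_eq_of_runRemAt` (+ `_adm`), ★ `endpointExistence_of_runRemAt_drift`, `runPackage_of_runRemAt_drift`.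
§3 (texts inline) ★★ `EndpointGivenBR13SepCoPH_of_runShadowingJetsGivenB`, `runRemAtSomeJetsGivenB_of_remAtSomeJets`, `d1AtShadowingJets_of_d1AtRunShadowingJets`,
`d1AtRunShadowingJets_of_drift_of_anchor`, `EndpointGivenBR13SepCoPH_of_runShadowingJetsGivenB_anchorRoad`.

HONEST FRAMING.  Definitions + elementary bookkeeping; NOTHING of Bałaban's analysis is asserted: every remainder ∕ anchor ∕ continuity ∕ drift is a HYPOTHESIS SHAPE
inhabited at no θ here (instance 0∕1); (P6) and `c⋆` NOT decided; K2⁷ ∕ its stubs ∕ N25 ∕ N26 NOT proved; counts unmoved; for Bałaban's β, continuity in the coupling is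
ASSERTED in print ([I] §1 pp. 263–264) with no located proof; [Balaban1987RG1] Thm 2 + (0.31) p. 259 (NODE O) is UNPROVED IN PRINT; route R4 closes the conditional
finite-𝕋⁴ rung only — NOT the continuum limit, NOT ℝ⁴, NOT OS, NOT a mass gap, NOT Clay.  No `instance`, no `notation`, no `axiom`.  Sources (context only; nothing printed
is used as a hypothesis): [I] = [Balaban1987RG1] CMP **109** (1987): Thm 2 p. 259 (first sentence), (0.20) p. 256, (1.3) p. 260, (1.20)–(1.22) p. 264, Thm 3 p. 264,
§1 pp. 263–264, (2.12)–(2.14) p. 268, (5.10) p. 293; [II] = [Balaban1988RG2Cluster] CMP **116** (1988): Lemma 3 (2.38) p. 20, (2.41) p. 21.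
-/

noncomputable section

namespace Summit.QuantumFields.YangMills.Theorems.BalabanUVNodesK2NamedJetsRunRemAt

open Finset
open scoped BigOperators
open Literature.MathematicalPhysics.QuantumFieldTheory.Balaban1983to89
open Literature.MathematicalPhysics.QuantumFieldTheory.Balaban1983to89.FlowStep
open Literature.MathematicalPhysics.QuantumFieldTheory.Balaban1983to89.DagBinding (EndpointExistence ForwardGenerated)
open Literature.MathematicalPhysics.QuantumFieldTheory.Balaban1983to89.T4Continuum (T4Family)
open Literature.MathematicalPhysics.QuantumFieldTheory.Balaban1983to89.Beta.Drift (OneLoopDrift sum_Ico_ge_of_drift)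
open Summit.QuantumFields.YangMills.Theorems.BalabanUVNodesK2JsOfRecord (StepColourData beta0OfJs)
open Summit.QuantumFields.YangMills.Theorems.BalabanUVNodesK2NamedJetsRemAt (RemAt ConstRemainder ScaleAnchor)
open Summit.QuantumFields.YangMills.Theorems.EndpointGivenBR13SepCoPH.Negative.RemNamedJets13FalseOfTwoNormalisations (oneLoopDrift_const_mul)
open Summit.QuantumFields.BalabanUV.Gaps.EndSurvivorCensus (endpointExistence_of_survivorLetters_runwisePS_locUpper survCont_of_betaContH)
open Summit.QuantumFields.BalabanUV.Gaps.EndRunwiseShooting (rgEqH_shoot_of_survives)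

/-! ## §1 Generic, split-free: the run-restricted letters and the END they give (tree consumer BY NAME) -/

section Generic

variable {β : HBeta} {b : ℕ → ℝ}

/-- **THE SURVIVOR SET of level `γ₀` at scale `k`** (the set of `Gaps/EndSurvivorCensus`, named): the bare couplings `x ∈ ]0, γ₀]` whose clamped forward run stays in
the window `]0, γ₀]` up to `k` (`1/γ₀² ≤ Y β γ₀ j x`, `j ≤ k`).  A definition over the tree's carriers `FlowStep.Y`; print context [I] Thm 3 p. 264 (runs `0 < g_k ≤ γ`). [folklore] -/
def Survivors (β : HBeta) (γ₀ : ℝ) (k : ℕ) : Set ℝ :=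
  {x : ℝ | 0 < x ∧ x ≤ γ₀ ∧ ∀ j, j ≤ k → 1 / γ₀ ^ 2 ≤ Y β γ₀ j x}

/-- HYPOTHESIS SHAPE (never a fact): **THE RUN-WISE CONSTANT REMAINDER of `β` relative to `b`** — `|β_{k+1}(g_0,…,g_k) − b_k| ≤ r` at every prefix of every solution of
(0.20) up to `n` that stays in `]0, γ₀]` (`RGEqH n β gs ∧ Step.InInterval γ₀ n gs`, `k ≤ n`): the RUN-RESTRICTION of ed.3's `ConstRemainder β b r γ₀`, in the shape of
the `hrun` letter of `Gaps/EndSurvivorCensus`.  A predicate over `(β, b, r, γ₀)`, never a fact; print context [I] Thm 3 p. 264 (β is read along such runs), (5.10) p. 293. [folklore] -/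
def RunConstRemainder (β : HBeta) (b : ℕ → ℝ) (r γ₀ : ℝ) : Prop :=
  ∀ (n : ℕ) (gs : ℕ → ℝ), RGEqH n β gs → Step.InInterval γ₀ n gs → ∀ k, k ≤ n → |β k (prefixOf gs k) - b k| ≤ r

/-- HYPOTHESIS SHAPE (never a fact): **RUN-WISE (C)** — the survivor-continuity letter of `Gaps/EndSurvivorCensus` (shape VERBATIM): each trace
`x ↦ β_k(clampPrefix β γ₀ k x)` is continuous ON the survivor set of level `γ₀` at scale `k`.  A predicate over `(β, γ₀)`, never a fact; print context [I] §1 pp. 263–264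
(continuity in the coupling, asserted there without proof). [folklore] -/
def SurvCont (β : HBeta) (γ₀ : ℝ) : Prop :=
  ∀ k : ℕ, ContinuousOn (fun x : ℝ => β k (clampPrefix β γ₀ k x)) (Survivors β γ₀ k)

/-- A run-wise remainder of level `γ₀` restricts to every smaller level (in-window runs of level `γ₀′ ≤ γ₀` are in-window runs of level `γ₀`). [folklore] -/
theorem RunConstRemainder.mono {r γ₀ γ₀' : ℝ} (h : RunConstRemainder β b r γ₀) (hle : γ₀' ≤ γ₀) : RunConstRemainder β b r γ₀' :=
  fun n gs hrg hI k hk => h n gs hrg (fun j hj => ⟨(hI j hj).1, (hI j hj).2.trans hle⟩) k hk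

/-- BOX ⟹ RUNS: a constant remainder on the `]0, γ₀]`-histories restricts to the in-window run prefixes (they lie in `HistBox γ₀`). [folklore] -/
theorem runConstRemainder_of_constRemainder {r γ₀ : ℝ} (h : ConstRemainder β b r γ₀) : RunConstRemainder β b r γ₀ :=
  fun _n gs _ hI k hk => h k (prefixOf gs k) fun i => hI i ((Nat.lt_succ_iff.mp i.isLt).trans hk)

/-- BOX ⟹ SURVIVORS: (C) on the boxes gives (C) on the survivor sets (`Gaps.EndSurvivorCensus.survCont_of_betaContH` BY NAME, re-read through the named set). [folklore] -/
theorem SurvCont.of_betaContH {γ₀ : ℝ} (hγ₀ : 0 < γ₀) (h : BetaContH γ₀ β) : SurvCont β γ₀ :=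
  survCont_of_betaContH hγ₀ h

/-- SURVIVORS ARE RUNS: at a survivor `x` of level `γ₀ > 0` at scale `k`, the clamped forward run is an in-window solution of (0.20) up to `k`
(`Gaps.EndRunwiseShooting.rgEqH_shoot_of_survives` BY NAME + the clamp's range `gClamp_pos` ∕ `gClamp_le`). [folklore] -/
theorem run_of_survivor {γ₀ : ℝ} (hγ₀ : 0 < γ₀) {k : ℕ} {x : ℝ} (hx : x ∈ Survivors β γ₀ k) :
    RGEqH k β (fun i => gClamp γ₀ (Y β γ₀ i x)) ∧ Step.InInterval γ₀ k (fun i => gClamp γ₀ (Y β γ₀ i x)) :=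
  ⟨rgEqH_shoot_of_survives hγ₀ hx.2.2, fun _ _ => ⟨gClamp_pos hγ₀ _, gClamp_le hγ₀ _⟩⟩

/-- THE RUN LETTER READ ON THE SURVIVOR TRACES: per-level bounds `β_k ≤ b_k + r` on the survivor sets (the `hsl` letter of Gaps' `_locUpper` road). [folklore] -/
theorem survUpper_of_runConstRemainder {r γ₀ : ℝ} (hγ₀ : 0 < γ₀) (h : RunConstRemainder β b r γ₀) (k : ℕ) (x : ℝ)
    (hx0 : 0 < x) (hxγ : x ≤ γ₀) (hsurv : ∀ j, j ≤ k → 1 / γ₀ ^ 2 ≤ Y β γ₀ j x) :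
    β k (clampPrefix β γ₀ k x) ≤ b k + r := by
  obtain ⟨hrg, hI⟩ := run_of_survivor (β := β) hγ₀ ⟨hx0, hxγ, hsurv⟩
  have h1 := (abs_le.mp (h k _ hrg hI k le_rfl)).2
  have e : prefixOf (fun i => gClamp γ₀ (Y β γ₀ i x)) k = clampPrefix β γ₀ k x := rfl
  rw [e] at h1
  linarith

/-- **RUN-WISE (PS) FROM A DRIFT AND THE RUN-WISE CONSTANT REMAINDER WITH THE CAP `r ≤ s`**: along every in-window run, every window sum of the β's is `≥ −2A`
(drift `|Σ_{j<k} b_j − s·k| ≤ A`, `Beta.Drift.sum_Ico_ge_of_drift` BY NAME; the lower remainder `β_j ≥ b_j − r` and the cap `r ≤ s`).  No sign of any individual β is read.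
[cite: Balaban1987RG1, Thm 2 p.259 (first sentence) and (2.12)–(2.14) p.268] -/
theorem runwisePS_of_drift_runConstRemainder {s A r γ₀ : ℝ} (hdrift : OneLoopDrift s A b) (hrem : RunConstRemainder β b r γ₀) (hr : r ≤ s) :
    ∀ (n : ℕ) (gs : ℕ → ℝ), RGEqH n β gs → Step.InInterval γ₀ n gs →
      ∀ k, k ≤ n → -(2 * A) ≤ ∑ j ∈ Finset.Ico k n, β j (prefixOf gs j) := by
  intro n gs hrg hI k hkn
  have hpt : ∀ j ∈ Finset.Ico k n, b j - r ≤ β j (prefixOf gs j) := by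
    intro j hj
    have hjn : j ≤ n := (Finset.mem_Ico.mp hj).2.le
    have := (abs_le.mp (hrem n gs hrg hI j hjn)).1
    linarith
  have hsum : ∑ j ∈ Finset.Ico k n, (b j - r) ≤ ∑ j ∈ Finset.Ico k n, β j (prefixOf gs j) := Finset.sum_le_sum hpt
  have hsplit : ∑ j ∈ Finset.Ico k n, (b j - r) = ∑ j ∈ Finset.Ico k n, b j - r * ((n : ℝ) - k) := by
    rw [Finset.sum_sub_distrib, Finset.sum_const, Nat.card_Ico, nsmul_eq_mul, Nat.cast_sub hkn]
    ring
  have hdr := sum_Ico_ge_of_drift hdrift hkn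
  have hnk : (0 : ℝ) ≤ (n : ℝ) - k := by
    have : (k : ℝ) ≤ n := by exact_mod_cast hkn
    linarith
  have hrs : r * ((n : ℝ) - k) ≤ s * ((n : ℝ) - k) := mul_le_mul_of_nonneg_right hr hnk
  linarith

/-- **★ ENDPOINT EXISTENCE FROM A DRIFT, THE RUN-WISE CONSTANT REMAINDER WITH THE CAP `r ≤ s`, AND RUN-WISE (C) ONLY** (forward-generated constructions): the TREE's
`Gaps.EndSurvivorCensus.endpointExistence_of_survivorLetters_runwisePS_locUpper` BY NAME (prior art g1-plan-2 GEN 19 ∕ pub-balaban-gaps g1-p3), fed the per-level survivor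
bounds `b_k + r` (`survUpper_of_runConstRemainder`) and the run-wise (PS) with `M := 2A` (`runwisePS_of_drift_runConstRemainder`).  The run-restricted twin of ed.3's
`endpointExistence_of_drift_constRemainder_cont`. [cite: Balaban1987RG1, Thm 2 p.259 (first sentence) and (5.10) p.293] -/
theorem endpointExistence_of_drift_runConstRemainder_survCont {C : B12.Construction} (hgen : ForwardGenerated C β) {γ₀ s A r : ℝ} (hγ₀ : 0 < γ₀)
    (hdrift : OneLoopDrift s A b) (hrem : RunConstRemainder β b r γ₀) (hr : r ≤ s) (hsc : SurvCont β γ₀) : EndpointExistence C :=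
  have hA : 0 ≤ A := hdrift.nonneg
  endpointExistence_of_survivorLetters_runwisePS_locUpper hgen hγ₀ (by positivity) hsc
    (fun k => ⟨b k + r, fun x hx0 hxγ hsurv => survUpper_of_runConstRemainder hγ₀ hrem k x hx0 hxγ hsurv⟩)
    (runwisePS_of_drift_runConstRemainder hdrift hrem hr)

end Generic

/-! ## §2 The run edition of the letter AT NODE 00's Stage-13 record (`N = 2`), read at a scale `c` -/

section Letter

/-- **THE RUN EDITION `RunRemAt F κ θ hP c` OF THE SHARED LETTER** (idea-4 ed.3's 2ᴮ currency; the one declarer's port): ed.3's `RemAt F κ θ hP c` (p593586) with the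
constant remainder read ALONG THE IN-WINDOW RUNS of the datum's own construction (`RunConstRemainder`) and (C) read ON THE SURVIVOR SETS (`SurvCont`); the per-scale
ANCHOR at `c • beta0OfJs F κ` KEPT BOX-WISE (identification clause, load-bearing; the (D1) road keys on it).  Same window `γ₀ ≤ θ.γ`, same cap `s ≤ c · stepBal 2 F.L`,
κ a letter ((P6) unpinned), normalisation carried by `c` (the stub texts put `c := θ.cβ`).  `hP` enters only through `(datumOfRecord₁₃SepCoPH F 2 θ hP).βfun`
(`runRemAt_iff_hPFree`).  A predicate over `(F, κ, θ, hP, c)`, never a fact; print context [I] Thm 3 p. 264 (β read along `0 < g_k ≤ γ, k = 0,…,K`),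
(2.12)–(2.14) p. 268, (5.10) p. 293, §1 pp. 263–264. [folklore] -/
def RunRemAt (F : T4Family) (κ : StepColourData) (θ : Node00.Stage13HParams F 2) (hP : θ.Provisos₁₃SepCoPH F 2) (c : ℝ) : Prop :=
  ∃ γ₀ s : ℝ, 0 < γ₀ ∧ γ₀ ≤ θ.γ ∧ s ≤ c * B12Normalization.stepBal 2 F.L ∧
    RunConstRemainder (Node00.datumOfRecord₁₃SepCoPH F 2 θ hP).βfun (fun k => c * beta0OfJs F κ k) s γ₀ ∧
    ScaleAnchor (Node00.datumOfRecord₁₃SepCoPH F 2 θ hP).βfun (fun k => c * beta0OfJs F κ k) ∧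
    SurvCont (Node00.datumOfRecord₁₃SepCoPH F 2 θ hP).βfun γ₀

variable (F : T4Family) (κ κ' : StepColourData) (θ : Node00.Stage13HParams F 2) (hP : θ.Provisos₁₃SepCoPH F 2)

/-- **`hP` IS A PHANTOM BINDER OF THE RUN EDITION TOO**: the datum's β IS `betaOfRecord₁₃ F 2 θ.toStage13Params` (`Node00.βfun_datumOfRecord₁₃SepCoPH`, `rfl`), so the
letter's CONTENT is a statement about the bare Stage-13 parameters — `Iff.rfl` (the keying on the provisos lives in the stub prefix). [folklore] -/
theorem runRemAt_iff_hPFree (c : ℝ) :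
    RunRemAt F κ θ hP c ↔
      ∃ γ₀ s : ℝ, 0 < γ₀ ∧ γ₀ ≤ θ.γ ∧ s ≤ c * B12Normalization.stepBal 2 F.L ∧
        RunConstRemainder (Node00.betaOfRecord₁₃ F 2 θ.toStage13Params) (fun k => c * beta0OfJs F κ k) s γ₀ ∧
        ScaleAnchor (Node00.betaOfRecord₁₃ F 2 θ.toStage13Params) (fun k => c * beta0OfJs F κ k) ∧
        SurvCont (Node00.betaOfRecord₁₃ F 2 θ.toStage13Params) γ₀ :=
  Iff.rfl

/-- **ED.3's LETTER ⟹ ITS RUN EDITION**, at every scale (so 2ᴮ″ is weaker than 2′ BY NAME). [folklore] -/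
theorem runRemAt_of_remAt {c : ℝ} (h : RemAt F κ θ hP c) : RunRemAt F κ θ hP c := by
  obtain ⟨γ₀, s, hγ₀, hγθ, hcap, hrem, hanch, hcont⟩ := h
  exact ⟨γ₀, s, hγ₀, hγθ, hcap, runConstRemainder_of_constRemainder hrem, hanch, SurvCont.of_betaContH hγ₀ hcont⟩

/-- **THE IDENTIFICATION SURVIVES THE RESTRICTION TO RUNS** (the anchor is box-wise): two colour data whose scaled numbers run-shadow the SAME record at the same scale
`c ≠ 0` have the SAME named one-loop numbers (`ScaleAnchor.eq_of_smul` BY NAME) — κ is no free knob under the run edition either. [folklore] -/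
theorem beta0OfJs_eq_of_runRemAt {c : ℝ} (hc : c ≠ 0) (h : RunRemAt F κ θ hP c) (h' : RunRemAt F κ' θ hP c) : beta0OfJs F κ = beta0OfJs F κ' := by
  obtain ⟨-, -, -, -, -, -, hanch, -⟩ := h
  obtain ⟨-, -, -, -, -, -, hanch', -⟩ := h'
  exact hanch.eq_of_smul hc hanch'

/-- … at the stub texts' scale `c := θ.cβ`, for an ADMISSIBLE tuple (`0 < θ.cβ`: Stage-9 admissibility's chart clause). [folklore] -/
theorem beta0OfJs_eq_of_runRemAt_adm (hθ : θ.Admissible F 2) (h : RunRemAt F κ θ hP θ.cβ) (h' : RunRemAt F κ' θ hP θ.cβ) :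
    beta0OfJs F κ = beta0OfJs F κ' :=
  beta0OfJs_eq_of_runRemAt F κ κ' θ hP (ne_of_gt hθ.toStage9.chart.1) h h'

/-- **★ THE END AT ONE RECORD FROM THE RUN EDITION AT SCALE `c` AND THE BARE DRIFT** of the named numbers (slope `stepBal 2 F.L`): the drift is rescaled by `c`
(`oneLoopDrift_const_mul` BY NAME, p592392) to the reference sequence `c • beta0OfJs F κ` and slope `c · stepBal 2 F.L`; then §1's consumer at the datum's `fwd`.  NO sign of
`c` is read; the anchor and `γ₀ ≤ θ.γ` are unread here.  CONDITIONAL; K2⁷ NOT closed. [cite: Balaban1987RG1, Thm 2 p.259 (first sentence), (5.10) p.293 and (2.12)–(2.14) p.268] -/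
theorem endpointExistence_of_runRemAt_drift {c : ℝ} (h : RunRemAt F κ θ hP c) {A : ℝ}
    (hdrift : OneLoopDrift (B12Normalization.stepBal 2 F.L) A (beta0OfJs F κ)) :
    EndpointExistence (Node00.datumOfRecord₁₃SepCoPH F 2 θ hP).C.toB12 := by
  obtain ⟨γ₀, s, hγ₀, -, hcap, hrem, -, hsc⟩ := h
  exact endpointExistence_of_drift_runConstRemainder_survCont (Node00.datumOfRecord₁₃SepCoPH F 2 θ hP).fwd hγ₀ (oneLoopDrift_const_mul hdrift c) hrem hcap hsc

/-- **THE OPENED PACKAGE A K1-SIDE READER CAN GET FROM THE RUN EDITION** (LOCATED difference to ed.3's `constAnchorPackage_of_remAt_drift`): from the run letter at scale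
`c` and a bare drift at one record — the run-wise (PS) letter with `M := 2·|c|·A` and PER-LEVEL survivor bounds `c · beta0OfJs F κ k + s`; NO box ceiling `BetaUpperH` and NO
box floor are recoverable from run data. [cite: Balaban1987RG1, (1.20)–(1.22) p.264, Thm 3 p.264 and (2.12)–(2.14) p.268] -/
theorem runPackage_of_runRemAt_drift {c : ℝ} (h : RunRemAt F κ θ hP c) {A : ℝ} (hdrift : OneLoopDrift (B12Normalization.stepBal 2 F.L) A (beta0OfJs F κ)) :
    ∃ γ₀ s : ℝ, 0 < γ₀ ∧ γ₀ ≤ θ.γ ∧ s ≤ c * B12Normalization.stepBal 2 F.L ∧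
      SurvCont (Node00.datumOfRecord₁₃SepCoPH F 2 θ hP).βfun γ₀ ∧
      (∀ (n : ℕ) (gs : ℕ → ℝ), RGEqH n (Node00.datumOfRecord₁₃SepCoPH F 2 θ hP).βfun gs → Step.InInterval γ₀ n gs →
        ∀ k, k ≤ n → -(2 * (|c| * A)) ≤ ∑ j ∈ Finset.Ico k n, (Node00.datumOfRecord₁₃SepCoPH F 2 θ hP).βfun j (prefixOf gs j)) ∧
      (∀ (k : ℕ) (x : ℝ), 0 < x → x ≤ γ₀ → (∀ j, j ≤ k → 1 / γ₀ ^ 2 ≤ Y (Node00.datumOfRecord₁₃SepCoPH F 2 θ hP).βfun γ₀ j x) →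
        (Node00.datumOfRecord₁₃SepCoPH F 2 θ hP).βfun k (clampPrefix (Node00.datumOfRecord₁₃SepCoPH F 2 θ hP).βfun γ₀ k x) ≤ c * beta0OfJs F κ k + s) := by
  obtain ⟨γ₀, s, hγ₀, hγθ, hcap, hrem, -, hsc⟩ := h
  exact ⟨γ₀, s, hγ₀, hγθ, hcap, hsc, runwisePS_of_drift_runConstRemainder (oneLoopDrift_const_mul hdrift c) hrem hcap,
    fun k x hx0 hxγ hsurv => survUpper_of_runConstRemainder hγ₀ hrem k x hx0 hxγ hsurv⟩

end Letter

/-! ## §3 The run-wise stub TEXTS (κ AFTER θ, scale `θ.cβ`, the item's guard and (B) as INPUTS of 2ᴮ″) INLINE, and the composition to K2⁷ BY NAME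

* 2ᴮ″ (XL; rows (D4) ∧ B4 at print's constant grade + anchor + (C), RUN-WISE, GIVEN the unity guard and (B)):
  `∀ F θ hP, (θ.ZhUnity F 2 ∧ θ.SlotsNondegenerate₁₃ F 2) → θ.Admissible F 2 → B16.EndStatementBPrinted (datumOfRecord₁₃SepCoPH F 2 θ hP).C → ∃ κ, RunRemAt F κ θ hP θ.cβ`.
* 1ᴮ″ (L; row (D1) at the record, carried by the run-shadowing named jets): `∀ F κ θ hP, θ.Admissible F 2 → RunRemAt F κ θ hP θ.cβ → ∃ A, OneLoopDrift (stepBal 2 F.L) A (beta0OfJs F κ)`.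
The texts belong to a registered skeleton (which tags them as obligations); here they are hypotheses spelled INLINE, VERBATIM as idea-4's sketch ed.3 spells them. -/

section Stubs

/-- **★★ THE RUN-WISE COMPOSITION (kernel-checked, no sorry): 1ᴮ″ → 2ᴮ″ → THE CRUX DECL BY NAME** (`Summit.QuantumFields.YangMills.Theses.BalabanUVNodes.EndpointGivenBR13SepCoPH`,
route rev 25; `h₁` = the 1ᴮ″ text, `h₂` = the 2ᴮ″ text, VERBATIM).  Per record: κ from 2ᴮ″ — which CONSUMES the item's unity guard `hU` and (B) `hB` —, the bare drift from 1ᴮ″,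
`endpointExistence_of_runRemAt_drift` (drift rescaled by `θ.cβ`).  The window hypothesis is unused.  CONDITIONAL on the two displayed hypothesis shapes; K2⁷ NOT closed;
nothing of Bałaban asserted. [cite: Balaban1987RG1, Thm 2 p.259 (first sentence), (5.10) p.293 and (2.12)–(2.14) p.268] -/
theorem EndpointGivenBR13SepCoPH_of_runShadowingJetsGivenB
    (h₁ : ∀ (F : T4Family) (κ : StepColourData) (θ : Node00.Stage13HParams F 2) (hP : θ.Provisos₁₃SepCoPH F 2), θ.Admissible F 2 →
      RunRemAt F κ θ hP θ.cβ → ∃ A : ℝ, OneLoopDrift (B12Normalization.stepBal 2 F.L) A (beta0OfJs F κ))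
    (h₂ : ∀ (F : T4Family) (θ : Node00.Stage13HParams F 2) (hP : θ.Provisos₁₃SepCoPH F 2),
      (θ.ZhUnity F 2 ∧ θ.SlotsNondegenerate₁₃ F 2) → θ.Admissible F 2 →
      B16.EndStatementBPrinted (Node00.datumOfRecord₁₃SepCoPH F 2 θ hP).C →
      ∃ κ : StepColourData, RunRemAt F κ θ hP θ.cβ) :
    Summit.QuantumFields.YangMills.Theses.BalabanUVNodes.EndpointGivenBR13SepCoPH := by
  intro F θ hP hU hθ hB _hwin
  obtain ⟨κ, hRun⟩ := h₂ F θ hP hU hθ hB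
  obtain ⟨A, hdrift⟩ := h₁ F κ θ hP hθ hRun
  exact endpointExistence_of_runRemAt_drift F κ θ hP hRun hdrift

/-- **v4's STUB 2′ TEXT ⟹ THE 2ᴮ″ TEXT** (weaker BY NAME: restriction to runs ∕ survivors, plus two extra inputs left unread). [folklore] -/
theorem runRemAtSomeJetsGivenB_of_remAtSomeJets
    (h : ∀ (F : T4Family) (θ : Node00.Stage13HParams F 2) (hP : θ.Provisos₁₃SepCoPH F 2), θ.Admissible F 2 →
      ∃ κ : StepColourData, RemAt F κ θ hP θ.cβ) :
    ∀ (F : T4Family) (θ : Node00.Stage13HParams F 2) (hP : θ.Provisos₁₃SepCoPH F 2),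
      (θ.ZhUnity F 2 ∧ θ.SlotsNondegenerate₁₃ F 2) → θ.Admissible F 2 →
      B16.EndStatementBPrinted (Node00.datumOfRecord₁₃SepCoPH F 2 θ hP).C →
      ∃ κ : StepColourData, RunRemAt F κ θ hP θ.cβ := fun F θ hP _ hθ _ => by
  obtain ⟨κ, hRem⟩ := h F θ hP hθ
  exact ⟨κ, runRemAt_of_remAt F κ θ hP hRem⟩

/-- **THE 1ᴮ″ TEXT ⟹ v4's STUB 1′ TEXT** (1ᴮ″ asks the drift under the WEAKER run hypothesis, so it is the stronger text; direction recorded so that no seat reads it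
backwards). [folklore] -/
theorem d1AtShadowingJets_of_d1AtRunShadowingJets
    (h : ∀ (F : T4Family) (κ : StepColourData) (θ : Node00.Stage13HParams F 2) (hP : θ.Provisos₁₃SepCoPH F 2), θ.Admissible F 2 →
      RunRemAt F κ θ hP θ.cβ → ∃ A : ℝ, OneLoopDrift (B12Normalization.stepBal 2 F.L) A (beta0OfJs F κ)) :
    ∀ (F : T4Family) (κ : StepColourData) (θ : Node00.Stage13HParams F 2) (hP : θ.Provisos₁₃SepCoPH F 2), θ.Admissible F 2 →
      RemAt F κ θ hP θ.cβ → ∃ A : ℝ, OneLoopDrift (B12Normalization.stepBal 2 F.L) A (beta0OfJs F κ) :=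
  fun F κ θ hP hθ hRem => h F κ θ hP hθ (runRemAt_of_remAt F κ θ hP hRem)

/-- **THE (D1) ROAD OF 1ᴮ″ IS ED.3's ANCHOR ROAD**: the anchor-keyed use form (hypothesis VERBATIM = that of ed.3's `d1AtShadowingJets_of_drift_of_anchor`) gives the 1ᴮ″
text, because `RunRemAt` keeps the box-wise anchor — ONE (D1) statement per record serves both the box pair and the run pair.
[cite: Balaban1987RG1, (1.3) p.260 and (2.12)–(2.14) p.268] -/
theorem d1AtRunShadowingJets_of_drift_of_anchor
    (h : ∀ (F : T4Family) (κ : StepColourData) (θ : Node00.Stage13HParams F 2) (hP : θ.Provisos₁₃SepCoPH F 2), θ.Admissible F 2 →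
      ScaleAnchor (Node00.datumOfRecord₁₃SepCoPH F 2 θ hP).βfun (fun k => θ.cβ * beta0OfJs F κ k) →
      ∃ A : ℝ, OneLoopDrift (B12Normalization.stepBal 2 F.L) A (beta0OfJs F κ)) :
    ∀ (F : T4Family) (κ : StepColourData) (θ : Node00.Stage13HParams F 2) (hP : θ.Provisos₁₃SepCoPH F 2), θ.Admissible F 2 →
      RunRemAt F κ θ hP θ.cβ → ∃ A : ℝ, OneLoopDrift (B12Normalization.stepBal 2 F.L) A (beta0OfJs F κ) := fun F κ θ hP hθ hRun => by
  obtain ⟨-, -, -, -, -, -, hanch, -⟩ := hRun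
  exact h F κ θ hP hθ hanch

/-- … so with the anchor-keyed (D1) road, the 2ᴮ″ text ALONE composes to the crux decl BY NAME. [cite: Balaban1987RG1, Thm 2 p.259 (first sentence) and (1.3) p.260] -/
theorem EndpointGivenBR13SepCoPH_of_runShadowingJetsGivenB_anchorRoad
    (hD1 : ∀ (F : T4Family) (κ : StepColourData) (θ : Node00.Stage13HParams F 2) (hP : θ.Provisos₁₃SepCoPH F 2), θ.Admissible F 2 →
      ScaleAnchor (Node00.datumOfRecord₁₃SepCoPH F 2 θ hP).βfun (fun k => θ.cβ * beta0OfJs F κ k) →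
      ∃ A : ℝ, OneLoopDrift (B12Normalization.stepBal 2 F.L) A (beta0OfJs F κ))
    (h₂ : ∀ (F : T4Family) (θ : Node00.Stage13HParams F 2) (hP : θ.Provisos₁₃SepCoPH F 2),
      (θ.ZhUnity F 2 ∧ θ.SlotsNondegenerate₁₃ F 2) → θ.Admissible F 2 →
      B16.EndStatementBPrinted (Node00.datumOfRecord₁₃SepCoPH F 2 θ hP).C →
      ∃ κ : StepColourData, RunRemAt F κ θ hP θ.cβ) :
    Summit.QuantumFields.YangMills.Theses.BalabanUVNodes.EndpointGivenBR13SepCoPH :=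
  EndpointGivenBR13SepCoPH_of_runShadowingJetsGivenB (d1AtRunShadowingJets_of_drift_of_anchor hD1) h₂

end Stubs

end Summit.QuantumFields.YangMills.Theorems.BalabanUVNodesK2NamedJetsRunRemAt

end
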